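import Summits.CriticalPhenomena.PercolationContinuityZ3.Theorems.PercNearOneGluingNoHeavyLowerTailIncStarWDOMAllOrNothing
import Summits.CriticalPhenomena.PercolationContinuityZ3.Theorems.PercNearOneGluingAdditiveGluingAL5UpsetTransfer
import HarnessLib

/-!
# The bottom fibre is a sink: `E[W | C^{(ij)} = {s}] ≤ E[W]` for every finite weighted graph (Sahi programme, prover prim-sahi-p2 gen 36)

Support file (`--supports stmt-CriticalPhenomena-4575`); no definitions, no named facts, no sorries; standard axioms.  Memo
`run/shared/lean/prim/prim-sahi/FROM-prim-sahi-p2-gen36-ALL-OR-NOTHING.md` §0(3)/(46d), `prim-sahi-p2/PROOF-E3.md` §46.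

With `W = 2·1{i,j ∈ C_s} − q_i·1{j ∈ C_s} − q_j·1{i ∈ C_s}` (constants of `G`) and `F` the non-target root pairs, **`bottomSink`**:
`2·P⁰(B_i ∩ B_j) − q_i·P⁰(B_j) − q_j·P⁰(B_i) ≤ 2 q_{ij} − 2 q_i q_j`, where `P⁰` is the law with `F` closed (the trivial avoiding cluster `C^{(ij)} = {s}`, a
two-pronged root) — the BETA-domination inequality for the coarsest up-family `{L ≠ {s}}`, true in every graph although BETA-domination itself is false (memo §1).
(Pattern weights: `al5u_pi_nonneg` of the additive-gluing files.)  Proof: decompose `P_w` over the patterns `O ⊆ F` (`real_patternDecomp`), apply the all-or-nothing root lemma `allOrNothing_root` to every pattern, and use Harris'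
inequality on the pattern cube (`patSum_chebyshev`, the FKG inequality for a product measure on `{0,1}^F` and two increasing functions, by induction on `F`).
-/

noncomputable section

namespace Summit.CriticalPhenomena.PercolationContinuityZ3.Theorems

namespace IncStar

open MeasureTheory Set Literature.Probability.Percolation Literature.Probability.LatticeModels EdgeInduction
open scoped Classical

variable {n : ℕ}

/-! ### Sums over the pattern cube `{0,1}^F` with product weights -/

/-- Splitting off one coordinate of the pattern cube. [folklore] -/
theorem patSum_insert (w : Sym2 (Fin n) → unitInterval) {F : Finset (Sym2 (Fin n))} {a : Sym2 (Fin n)} (ha : a ∉ F)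
    (h : Finset (Sym2 (Fin n)) → ℝ) :
    ∑ O ∈ (insert a F).powerset, ((∏ e ∈ O, (w e : ℝ)) * ∏ e ∈ insert a F \ O, (1 - (w e : ℝ))) * h O
      = (w a : ℝ) * ∑ O ∈ F.powerset, ((∏ e ∈ O, (w e : ℝ)) * ∏ e ∈ F \ O, (1 - (w e : ℝ))) * h (insert a O)
        + (1 - (w a : ℝ)) * ∑ O ∈ F.powerset, ((∏ e ∈ O, (w e : ℝ)) * ∏ e ∈ F \ O, (1 - (w e : ℝ))) * h O := by
  rw [Finset.sum_powerset_insert ha, add_comm, Finset.mul_sum, Finset.mul_sum]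
  congr 1
  · refine Finset.sum_congr rfl fun O hO => ?_
    have hOF : O ⊆ F := Finset.mem_powerset.1 hO
    have haO : a ∉ O := fun h' => ha (hOF h')
    rw [Finset.prod_insert haO, Finset.insert_sdiff_insert, Finset.sdiff_insert_of_notMem ha]
    ring
  · refine Finset.sum_congr rfl fun O hO => ?_
    have hOF : O ⊆ F := Finset.mem_powerset.1 hO
    have haO : a ∉ O := fun h' => ha (hOF h')
    have haFO : a ∉ F \ O := fun h' => ha (Finset.mem_sdiff.1 h').1
    rw [Finset.insert_sdiff_of_notMem F haO, Finset.prod_insert haFO]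
    ring

/-- The product weights on the pattern cube sum to `1`. [folklore] -/
theorem patSum_one (w : Sym2 (Fin n) → unitInterval) (F : Finset (Sym2 (Fin n))) :
    ∑ O ∈ F.powerset, ((∏ e ∈ O, (w e : ℝ)) * ∏ e ∈ F \ O, (1 - (w e : ℝ))) * (1 : ℝ) = 1 := by
  induction F using Finset.induction_on with
  | empty => simp
  | @insert a F ha ih =>
    rw [patSum_insert w ha (fun _ => (1 : ℝ)), ih]; ring

/-- Monotone functions on the pattern cube have monotone pattern sums. [folklore] -/
theorem patSum_mono (w : Sym2 (Fin n) → unitInterval) (F : Finset (Sym2 (Fin n))) {f g : Finset (Sym2 (Fin n)) → ℝ}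
    (hfg : ∀ O, O ⊆ F → f O ≤ g O) :
    ∑ O ∈ F.powerset, ((∏ e ∈ O, (w e : ℝ)) * ∏ e ∈ F \ O, (1 - (w e : ℝ))) * f O
      ≤ ∑ O ∈ F.powerset, ((∏ e ∈ O, (w e : ℝ)) * ∏ e ∈ F \ O, (1 - (w e : ℝ))) * g O :=
  Finset.sum_le_sum fun O hO => mul_le_mul_of_nonneg_left (hfg O (Finset.mem_powerset.1 hO)) (al5u_pi_nonneg w F O)

/-- **Harris / FKG on the pattern cube.**  For `f, g` increasing (`O ⊆ O' → f O ≤ f O'`) on the subsets of `F`, the product-weighted mean of `f·g` is at least the product of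
the means. [folklore; Harris 1960] -/
theorem patSum_chebyshev (w : Sym2 (Fin n) → unitInterval) (F : Finset (Sym2 (Fin n))) (f g : Finset (Sym2 (Fin n)) → ℝ)
    (hf : ∀ O O', O ⊆ O' → f O ≤ f O') (hg : ∀ O O', O ⊆ O' → g O ≤ g O') :
    (∑ O ∈ F.powerset, ((∏ e ∈ O, (w e : ℝ)) * ∏ e ∈ F \ O, (1 - (w e : ℝ))) * f O)
      * (∑ O ∈ F.powerset, ((∏ e ∈ O, (w e : ℝ)) * ∏ e ∈ F \ O, (1 - (w e : ℝ))) * g O)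
      ≤ ∑ O ∈ F.powerset, ((∏ e ∈ O, (w e : ℝ)) * ∏ e ∈ F \ O, (1 - (w e : ℝ))) * (f O * g O) := by
  induction F using Finset.induction_on generalizing f g with
  | empty => simp
  | @insert a F ha ih =>
    rw [patSum_insert w ha f, patSum_insert w ha g, patSum_insert w ha (fun O => f O * g O)]
    set p : ℝ := (w a : ℝ) with hp
    have hp0 : 0 ≤ p := (w a).2.1
    have hp1 : p ≤ 1 := (w a).2.2
    set a1 := ∑ O ∈ F.powerset, ((∏ e ∈ O, (w e : ℝ)) * ∏ e ∈ F \ O, (1 - (w e : ℝ))) * f (insert a O) with ha1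
    set a0 := ∑ O ∈ F.powerset, ((∏ e ∈ O, (w e : ℝ)) * ∏ e ∈ F \ O, (1 - (w e : ℝ))) * f O with ha0
    set b1 := ∑ O ∈ F.powerset, ((∏ e ∈ O, (w e : ℝ)) * ∏ e ∈ F \ O, (1 - (w e : ℝ))) * g (insert a O) with hb1
    set b0 := ∑ O ∈ F.powerset, ((∏ e ∈ O, (w e : ℝ)) * ∏ e ∈ F \ O, (1 - (w e : ℝ))) * g O with hb0
    set c1 := ∑ O ∈ F.powerset, ((∏ e ∈ O, (w e : ℝ)) * ∏ e ∈ F \ O, (1 - (w e : ℝ))) * (f (insert a O) * g (insert a O)) with hc1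
    set c0 := ∑ O ∈ F.powerset, ((∏ e ∈ O, (w e : ℝ)) * ∏ e ∈ F \ O, (1 - (w e : ℝ))) * (f O * g O) with hc0
    have h1 : a1 * b1 ≤ c1 :=
      ih (fun O => f (insert a O)) (fun O => g (insert a O))
        (fun O O' hOO' => hf _ _ (Finset.insert_subset_insert a hOO')) (fun O O' hOO' => hg _ _ (Finset.insert_subset_insert a hOO'))
    have h0 : a0 * b0 ≤ c0 := ih f g hf hg
    have hma : a0 ≤ a1 := patSum_mono w F fun O _ => hf O _ (Finset.subset_insert a O)
    have hmb : b0 ≤ b1 := patSum_mono w F fun O _ => hg O _ (Finset.subset_insert a O)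
    have key : (p * a1 + (1 - p) * a0) * (p * b1 + (1 - p) * b0) ≤ p * (a1 * b1) + (1 - p) * (a0 * b0) := by
      nlinarith [mul_nonneg (mul_nonneg hp0 (sub_nonneg.2 hp1)) (mul_nonneg (sub_nonneg.2 hma) (sub_nonneg.2 hmb))]
    calc (p * a1 + (1 - p) * a0) * (p * b1 + (1 - p) * b0)
        ≤ p * (a1 * b1) + (1 - p) * (a0 * b0) := key
      _ ≤ p * c1 + (1 - p) * c0 := by
          have := mul_le_mul_of_nonneg_left h1 hp0
          have := mul_le_mul_of_nonneg_left h0 (sub_nonneg.2 hp1)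
          linarith

/-! ### Decomposition of a product law over the patterns of a finite set of pairs -/

/-- **Pattern decomposition.**  `P_w(X) = Σ_{O ⊆ F} (Π_{e∈O} w_e)(Π_{e∈F∖O}(1−w_e)) · P_{w[O↦1][F∖O↦0]}(X)`. [folklore] -/
theorem real_patternDecomp (F : Finset (Sym2 (Fin n))) (w : Sym2 (Fin n) → unitInterval) (X : Set (BondConfig (Fin n))) :
    (prodBernoulli w).real X = ∑ O ∈ F.powerset, ((∏ e ∈ O, (w e : ℝ)) * ∏ e ∈ F \ O, (1 - (w e : ℝ))) *
      (prodBernoulli (fun e => if e ∈ O then 1 else if e ∈ F then 0 else w e)).real X := by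
  induction F using Finset.induction_on generalizing w with
  | empty => simp
  | @insert a F ha ih =>
    rw [patSum_insert w ha, stub_oneBondDecomp_k15 n w a X, ih (Function.update w a 1), ih (Function.update w a 0)]
    have hwt : ∀ (c : unitInterval), ∀ O ∈ F.powerset,
        (∏ e ∈ O, ((Function.update w a c e : unitInterval) : ℝ)) * ∏ e ∈ F \ O, (1 - ((Function.update w a c e : unitInterval) : ℝ))
          = (∏ e ∈ O, (w e : ℝ)) * ∏ e ∈ F \ O, (1 - (w e : ℝ)) := by
      intro c O hO
      have hOF : O ⊆ F := Finset.mem_powerset.1 hO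
      rw [Finset.prod_congr rfl (fun e he => by rw [Function.update_of_ne (fun h : e = a => ha (h ▸ hOF he))]),
        Finset.prod_congr rfl (fun e (he : e ∈ F \ O) => by rw [Function.update_of_ne (fun h : e = a => ha (h ▸ (Finset.mem_sdiff.1 he).1))])]
    have e1 : ∀ O ∈ F.powerset,
        ((∏ e ∈ O, ((Function.update w a 1 e : unitInterval) : ℝ)) * ∏ e ∈ F \ O, (1 - ((Function.update w a 1 e : unitInterval) : ℝ))) *
            (prodBernoulli (fun e => if e ∈ O then 1 else if e ∈ F then 0 else Function.update w a 1 e)).real X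
          = ((∏ e ∈ O, (w e : ℝ)) * ∏ e ∈ F \ O, (1 - (w e : ℝ))) *
            (prodBernoulli (fun e => if e ∈ insert a O then 1 else if e ∈ insert a F then 0 else w e)).real X := by
      intro O hO
      have hOF : O ⊆ F := Finset.mem_powerset.1 hO
      rw [hwt 1 O hO]
      have hpat : (fun e => if e ∈ O then (1 : unitInterval) else if e ∈ F then 0 else Function.update w a 1 e)
          = (fun e => if e ∈ insert a O then (1 : unitInterval) else if e ∈ insert a F then 0 else w e) := by
        funext e
        by_cases hea : e = a
        · subst hea
          have h1 : e ∉ O := fun h => ha (hOF h)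
          simp only [h1, if_false, ha, Function.update_self, Finset.mem_insert_self, if_true]
        · simp only [Finset.mem_insert, hea, false_or, Function.update_of_ne hea]
      rw [hpat]
    have e0 : ∀ O ∈ F.powerset,
        ((∏ e ∈ O, ((Function.update w a 0 e : unitInterval) : ℝ)) * ∏ e ∈ F \ O, (1 - ((Function.update w a 0 e : unitInterval) : ℝ))) *
            (prodBernoulli (fun e => if e ∈ O then 1 else if e ∈ F then 0 else Function.update w a 0 e)).real X
          = ((∏ e ∈ O, (w e : ℝ)) * ∏ e ∈ F \ O, (1 - (w e : ℝ))) *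
            (prodBernoulli (fun e => if e ∈ O then 1 else if e ∈ insert a F then 0 else w e)).real X := by
      intro O hO
      have hOF : O ⊆ F := Finset.mem_powerset.1 hO
      rw [hwt 0 O hO]
      have hpat : (fun e => if e ∈ O then (1 : unitInterval) else if e ∈ F then 0 else Function.update w a 0 e)
          = (fun e => if e ∈ O then (1 : unitInterval) else if e ∈ insert a F then 0 else w e) := by
        funext e
        by_cases hea : e = a
        · subst hea
          have h1 : e ∉ O := fun h => ha (hOF h)
          simp only [h1, if_false, ha, Function.update_self, Finset.mem_insert_self, if_true]
        · simp only [Finset.mem_insert, hea, false_or, Function.update_of_ne hea]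
      rw [hpat]
    rw [Finset.sum_congr rfl e1, Finset.sum_congr rfl e0]
    ring

/-! ### The bottom fibre is a sink -/

/-- **BOTTOM-SINK THEOREM.**  `s, i, j` distinct; `F` a finite set of pairs containing `s`, with `s(s,i), s(s,j) ∉ F`, covering every other root pair of positive weight;
`w⁰ = w[F ↦ 0]` (the two-pronged root: the law conditioned on `C^{(ij)} = {s}`).  Then, with `q_v = P_w(s↔v)`, `q_{ij} = P_w(s↔i, s↔j)`:
`2·P_{w⁰}(B_i∩B_j) − q_i·P_{w⁰}(B_j) − q_j·P_{w⁰}(B_i) ≤ 2q_{ij} − 2q_iq_j`, i.e. `E[W | all non-target root pairs closed] ≤ E[W]`. [this work] -/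
theorem bottomSink (w : Sym2 (Fin n) → unitInterval) {s i j : Fin n} (his : i ≠ s) (hjs : j ≠ s) (hij : i ≠ j)
    (F : Finset (Sym2 (Fin n))) (hF : ∀ e ∈ F, s ∈ e) (hFi : s(s, i) ∉ F) (hFj : s(s, j) ∉ F)
    (hcover : ∀ v : Fin n, v ≠ s → v ≠ i → v ≠ j → s(s, v) ∈ F ∨ w s(s, v) = 0)
    (w0 : Sym2 (Fin n) → unitInterval) (hw0 : w0 = fun e => if e ∈ F then 0 else w e) :
    2 * (prodBernoulli w0).real (openConn s i ∩ openConn s j)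
      - (prodBernoulli w).real (openConn s i) * (prodBernoulli w0).real (openConn s j)
      - (prodBernoulli w).real (openConn s j) * (prodBernoulli w0).real (openConn s i)
      ≤ 2 * (prodBernoulli w).real (openConn s i ∩ openConn s j)
        - 2 * ((prodBernoulli w).real (openConn s i) * (prodBernoulli w).real (openConn s j)) := by
  set Bi : Set (BondConfig (Fin n)) := openConn s i with hBi
  set Bj : Set (BondConfig (Fin n)) := openConn s j with hBj
  have hroot0 : ∀ v : Fin n, v ≠ s → v ≠ i → v ≠ j → w0 s(s, v) = 0 := by
    intro v hv hi hj
    rw [hw0]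
    rcases hcover v hv hi hj with h | h
    · simp only [h, if_true]
    · by_cases hm : s(s, v) ∈ F
      · simp only [hm, if_true]
      · simp only [hm, if_false, h]
  -- pattern laws and their monotonicity
  have hpatw : ∀ O : Finset (Sym2 (Fin n)), O ⊆ F →
      (fun e => if e ∈ O then (1 : unitInterval) else if e ∈ F then 0 else w e) = (fun e => if e ∈ O then 1 else w0 e) := by
    intro O _; rw [hw0]
  have mono : ∀ X : Set (BondConfig (Fin n)), IsUpperSet X → ∀ O O' : Finset (Sym2 (Fin n)), O ⊆ O' →
      (prodBernoulli (fun e => if e ∈ O then (1 : unitInterval) else w0 e)).real X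
        ≤ (prodBernoulli (fun e => if e ∈ O' then (1 : unitInterval) else w0 e)).real X := by
    intro X hX O O' hOO'
    calc (prodBernoulli (fun e => if e ∈ O then (1 : unitInterval) else w0 e)).real X
        ≤ (prodBernoulli (fun e => if e ∈ O then (1 : unitInterval) else w0 e)).real
            ((fun ω : BondConfig (Fin n) => ω ∪ (↑O' : Set (Sym2 (Fin n)))) ⁻¹' X) :=
          measureReal_mono fun ω hω => hX Set.subset_union_left hω
      _ = (prodBernoulli (fun e => if e ∈ O' then (1 : unitInterval) else w0 e)).real X := by
          rw [← real_map_union]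
          refine congrArg (fun v : Sym2 (Fin n) → unitInterval => (prodBernoulli v).real X) ?_
          funext e
          by_cases h' : e ∈ O'
          · simp [h']
          · have h'' : e ∉ O := fun h => h' (hOO' h)
            simp [h', h'']
  -- decompositions of the constants
  have dI := real_patternDecomp F w Bi
  have dJ := real_patternDecomp F w Bj
  have dIJ := real_patternDecomp F w (Bi ∩ Bj)
  have hone := patSum_one w F
  simp only [mul_one] at hone
  -- the all-or-nothing lemma on every pattern
  have aon : ∀ O ∈ F.powerset,
      (prodBernoulli (fun e => if e ∈ O then (1 : unitInterval) else w0 e)).real Bi *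
          ((prodBernoulli (fun e => if e ∈ O then (1 : unitInterval) else w0 e)).real Bj - (prodBernoulli w0).real Bj)
        + (prodBernoulli (fun e => if e ∈ O then (1 : unitInterval) else w0 e)).real Bj *
          ((prodBernoulli (fun e => if e ∈ O then (1 : unitInterval) else w0 e)).real Bi - (prodBernoulli w0).real Bi)
        ≤ 2 * ((prodBernoulli (fun e => if e ∈ O then (1 : unitInterval) else w0 e)).real (Bi ∩ Bj) - (prodBernoulli w0).real (Bi ∩ Bj)) := by
    intro O hO
    have hOF : O ⊆ F := Finset.mem_powerset.1 hO
    exact allOrNothing_root w0 _ his hjs hij (↑O : Set (Sym2 (Fin n))) (fun e he => hF e (hOF (Finset.mem_coe.1 he)))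
      (fun h => hFi (hOF (Finset.mem_coe.1 h))) (fun h => hFj (hOF (Finset.mem_coe.1 h))) hroot0
      (by funext e; by_cases h : e ∈ O <;> simp [h])
  -- Harris on the pattern cube for `O ↦ A_O`, `O ↦ B_O`
  have cheb := patSum_chebyshev w F (fun O => (prodBernoulli (fun e => if e ∈ O then (1 : unitInterval) else w0 e)).real Bi)
    (fun O => (prodBernoulli (fun e => if e ∈ O then (1 : unitInterval) else w0 e)).real Bj)
    (fun O O' h => mono Bi (isUpperSet_openConn s i) O O' h) (fun O O' h => mono Bj (isUpperSet_openConn s j) O O' h)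
  -- rewrite the decompositions in terms of the pattern laws `w0[O ↦ 1]`
  rw [Finset.sum_congr rfl (fun O hO => by rw [hpatw O (Finset.mem_powerset.1 hO)])] at dI dJ dIJ
  -- sum the all-or-nothing inequalities with the pattern weights
  have hsum : 0 ≤ ∑ O ∈ F.powerset, ((∏ e ∈ O, (w e : ℝ)) * ∏ e ∈ F \ O, (1 - (w e : ℝ))) *
      (2 * ((prodBernoulli (fun e => if e ∈ O then (1 : unitInterval) else w0 e)).real (Bi ∩ Bj) - (prodBernoulli w0).real (Bi ∩ Bj))
        - ((prodBernoulli (fun e => if e ∈ O then (1 : unitInterval) else w0 e)).real Bi *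
            ((prodBernoulli (fun e => if e ∈ O then (1 : unitInterval) else w0 e)).real Bj - (prodBernoulli w0).real Bj)
          + (prodBernoulli (fun e => if e ∈ O then (1 : unitInterval) else w0 e)).real Bj *
            ((prodBernoulli (fun e => if e ∈ O then (1 : unitInterval) else w0 e)).real Bi - (prodBernoulli w0).real Bi))) :=
    Finset.sum_nonneg fun O hO => mul_nonneg (al5u_pi_nonneg w F O) (by linarith [aon O hO])
  -- expand the sum
  have hexp : ∑ O ∈ F.powerset, ((∏ e ∈ O, (w e : ℝ)) * ∏ e ∈ F \ O, (1 - (w e : ℝ))) *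
      (2 * ((prodBernoulli (fun e => if e ∈ O then (1 : unitInterval) else w0 e)).real (Bi ∩ Bj) - (prodBernoulli w0).real (Bi ∩ Bj))
        - ((prodBernoulli (fun e => if e ∈ O then (1 : unitInterval) else w0 e)).real Bi *
            ((prodBernoulli (fun e => if e ∈ O then (1 : unitInterval) else w0 e)).real Bj - (prodBernoulli w0).real Bj)
          + (prodBernoulli (fun e => if e ∈ O then (1 : unitInterval) else w0 e)).real Bj *
            ((prodBernoulli (fun e => if e ∈ O then (1 : unitInterval) else w0 e)).real Bi - (prodBernoulli w0).real Bi)))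
      = 2 * (prodBernoulli w).real (Bi ∩ Bj) - 2 * (prodBernoulli w0).real (Bi ∩ Bj)
        - 2 * ∑ O ∈ F.powerset, ((∏ e ∈ O, (w e : ℝ)) * ∏ e ∈ F \ O, (1 - (w e : ℝ))) *
            ((prodBernoulli (fun e => if e ∈ O then (1 : unitInterval) else w0 e)).real Bi *
              (prodBernoulli (fun e => if e ∈ O then (1 : unitInterval) else w0 e)).real Bj)
        + (prodBernoulli w0).real Bj * (prodBernoulli w).real Bi + (prodBernoulli w0).real Bi * (prodBernoulli w).real Bj := by
    rw [dI, dJ, dIJ]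
    have h2 : (2 : ℝ) * (prodBernoulli w0).real (Bi ∩ Bj) = 2 * (prodBernoulli w0).real (Bi ∩ Bj) *
        ∑ O ∈ F.powerset, ((∏ e ∈ O, (w e : ℝ)) * ∏ e ∈ F \ O, (1 - (w e : ℝ))) := by rw [hone, mul_one]
    rw [h2]
    simp only [Finset.mul_sum]
    rw [← Finset.sum_sub_distrib, ← Finset.sum_sub_distrib, ← Finset.sum_add_distrib, ← Finset.sum_add_distrib]
    exact Finset.sum_congr rfl fun O _ => by ring
  rw [hexp] at hsum
  rw [← dI, ← dJ] at cheb
  linarith [hsum, cheb]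

end IncStar

end Summit.CriticalPhenomena.PercolationContinuityZ3.Theorems
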